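import Summits.ValiantsHypothesis.ValiantsHypothesis.Theorems.LacunarySymmetroidMatrixDescartesLowRankSector

/-!
# Tower graft line — the SHARP RANK-CAPPED DESCARTES CEILING at every size: letters of ranks `ρ_l` give at most
# `#{n : Σ n_l = m, n_l ≤ ρ_l}` monomials; RANK-ONE pencils have `Z₊ ≤ C(K, m) − 1`

Crux `stmt-ValiantsHypothesis-19561` (`Theses.KPlusLogSqLaw.WeakLifting`), line (B) `Cruxes/WeakLifting/Lines/tower_graft.lean`
(S4b/S4c rank-one grafts, S4d/S4f size doubling, S5).  Companion of `…TowerGraftIsotropicLetters` (the `m = 2` row, p821823).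

HONEST FRAMING.  A size-free MONOMIAL COUNT governed by letter rank, sharpening the tree's low-rank ceiling
`LowRankSector.lowRankCeiling` (`Z₊ + 1 ≤ ∏_{l ≠ l₀} (rank S_l + 1)`) to the exact count of admissible class-count vectors; it proves
nothing about `WeakLifting`, Conjecture B / `KPlusLogSqLaw`, the registered stubs, `MatrixDescartes` (18050) or `VP ≠ VNP`.  Def-free helper;
general real letters (no symmetry).

By the tree's row-choice expansion (`LowRankSector.det_pencil_eq_sum_rowChoice`: `det ∑_l X^{d_l} S_l = ∑_{f : Fin m → Fin K}
X^{∑_i d(f i)} · det N_f`) and its rank vanishing (`LowRankSector.det_rowChoice_eq_zero`: `det N_f = 0` as soon as some letter is chosen by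
more than `rank S_l` rows), every monomial of the determinant is `X^{∑_l n_l d_l}` for a count vector `n` with `∑_l n_l = m` and
`n_l ≤ rank S_l`:

* `support_det_pencil_subset_counts` / `card_support_det_pencil_le_card_counts` — `supp det ⊆` the image of the admissible count vectors,
  `#supp ≤ #{n ∈ ∏_l [0, rank S_l] : ∑ n = m}`; `card_posRoots_lt_card_counts` — Descartes: `Z₊ <` that number (determinant `≠ 0`);
* `support_det_pencil_subset_powersetCard_of_rank_le_one` / `card_support_le_choose_of_rank_le_one` /
  **`card_posRoots_le_choose_sub_one_of_rank_le_one`** — ALL letters of rank `≤ 1`: the row choice is injective, the monomials are the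
  `m`-subsets of the letters, `#supp ≤ C(K, m)` and `Z₊ ≤ C(K, m) − 1` at EVERY size (`m = 2`: `C(K,2) − 1`, the isotropic row of the
  companion file; `m = K − 1`: `≤ K − 1`; `m ≥ K`: NO positive zero — `card_posRoots_eq_zero_of_rank_le_one_of_le`), against the tree's
  `2^{K−1} − 1` (`lowRankCeiling_uniform` with `r = 1`) and the format ceiling `C(m+K−1, m) − 1`.

Reading for the line: a pencil all of whose letters are rank-one grafts `t^{d_l} v_l w_lᵀ` is Descartes-trivial at sizes `m ≥ K − 1`; every
located record of the census uses letters of rank `≥ 2` in number growing with the root count (companion file at `m = 2`).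

[folklore] Descartes' rule of signs by monomial count; row-multilinearity of the determinant.
-/

-- `Summit.ValiantsHypothesis.ValiantsHypothesis.…` repeats a component by the D-0017 layout
-- (single-conjunct summit), which the `dupNamespace` linter flags; the name is mandated.
set_option linter.dupNamespace false
set_option autoImplicit false

namespace Summit.ValiantsHypothesis.ValiantsHypothesis.Theorems.KPlusLogSqLaw.TowerGraft.RankOnePencils

open Polynomial Matrix Finset
open scoped BigOperators Polynomial
open Summit.ValiantsHypothesis.ValiantsHypothesis.Theorems.LacunarySymmetroidMatrixDescartes.LowRankSector
  (det_pencil_eq_sum_rowChoice det_rowChoice_eq_zero sum_exp_eq_sum_count sum_count_eq)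

variable {K m : ℕ}

/-- A monomial of the pencil determinant is carried by a row choice `f` with non-singular row matrix `N_f` and the right exponent. [folklore] -/
theorem exists_rowChoice_of_mem_support (d : Fin K → ℕ) (S : Fin K → Matrix (Fin m) (Fin m) ℝ) {e : ℕ}
    (he : e ∈ (Matrix.det (∑ l, ((X : ℝ[X]) ^ d l) • (S l).map C)).support) :
    ∃ f : Fin m → Fin K, e = ∑ i, d (f i) ∧ Matrix.det (Matrix.of fun i j => S (f i) i j) ≠ 0 := by
  rw [mem_support_iff, det_pencil_eq_sum_rowChoice, finsetSum_coeff] at he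
  obtain ⟨f, -, hf⟩ := Finset.exists_ne_zero_of_sum_ne_zero he
  rw [X_pow_mul, coeff_C_mul_X_pow] at hf
  refine ⟨f, ?_, ?_⟩
  · by_contra hne
    exact hf (if_neg hne)
  · intro h0
    apply hf
    rw [h0]
    split_ifs <;> rfl

/-- The count vector of a row choice with non-singular row matrix is rank-admissible: letter `l` is chosen by at most `rank S_l` rows. [folklore] -/
theorem count_le_rank_of_det_ne_zero (S : Fin K → Matrix (Fin m) (Fin m) ℝ) (f : Fin m → Fin K)
    (hf : Matrix.det (Matrix.of fun i j => S (f i) i j) ≠ 0) (l : Fin K) :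
    (univ.filter fun i => f i = l).card ≤ (S l).rank := by
  by_contra h
  exact hf (det_rowChoice_eq_zero S f l (not_le.mp h))

/-- **Support ⊆ admissible count vectors.**  Every monomial of `det ∑_l X^{d_l} S_l` is `X^{∑_l n_l d_l}` for a count vector `n` with
`n_l ≤ rank S_l` and `∑_l n_l = m`. [folklore] -/
theorem support_det_pencil_subset_counts (d : Fin K → ℕ) (S : Fin K → Matrix (Fin m) (Fin m) ℝ) :
    (Matrix.det (∑ l, ((X : ℝ[X]) ^ d l) • (S l).map C)).support ⊆
      ((Fintype.piFinset fun l => Finset.range ((S l).rank + 1)).filter (fun n => ∑ l, n l = m)).image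
        (fun n : Fin K → ℕ => ∑ l, n l * d l) := by
  intro e he
  obtain ⟨f, hef, hf⟩ := exists_rowChoice_of_mem_support d S he
  rw [Finset.mem_image]
  refine ⟨fun l => (univ.filter fun i => f i = l).card, ?_, ?_⟩
  · rw [Finset.mem_filter, Fintype.mem_piFinset]
    refine ⟨fun l => Finset.mem_range.mpr (Nat.lt_succ_of_le (count_le_rank_of_det_ne_zero S f hf l)), ?_⟩
    exact sum_count_eq f
  · rw [hef, sum_exp_eq_sum_count]

/-- **SHARP RANK-CAPPED MONOMIAL COUNT.**  `#supp det ≤ #{n ∈ ∏_l [0, rank S_l] : ∑_l n_l = m}`. [folklore] -/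
theorem card_support_det_pencil_le_card_counts (d : Fin K → ℕ) (S : Fin K → Matrix (Fin m) (Fin m) ℝ) :
    (Matrix.det (∑ l, ((X : ℝ[X]) ^ d l) • (S l).map C)).support.card ≤
      ((Fintype.piFinset fun l => Finset.range ((S l).rank + 1)).filter (fun n => ∑ l, n l = m)).card :=
  (Finset.card_le_card (support_det_pencil_subset_counts d S)).trans Finset.card_image_le

/-- **SHARP RANK-CAPPED DESCARTES CEILING** (size-free): if the determinant is not the zero polynomial, its number of distinct positive
zeros is less than the number of rank-admissible count vectors. [folklore] -/
theorem card_posRoots_lt_card_counts (d : Fin K → ℕ) (S : Fin K → Matrix (Fin m) (Fin m) ℝ)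
    (hP : Matrix.det (∑ l, ((X : ℝ[X]) ^ d l) • (S l).map C) ≠ 0) :
    ((Matrix.det (∑ l, ((X : ℝ[X]) ^ d l) • (S l).map C)).roots.toFinset.filter (fun t => 0 < t)).card <
      ((Fintype.piFinset fun l => Finset.range ((S l).rank + 1)).filter (fun n => ∑ l, n l = m)).card :=
  (Literature.Computability.AlgebraicComplexity.card_roots_toFinset_filter_pos_lt_card_support hP).trans_le
    (card_support_det_pencil_le_card_counts d S)

/-! ## Rank-one letters: the monomials are the `m`-subsets of the letters -/

/-- With all letters of rank `≤ 1`, a row choice with non-singular row matrix is injective. [folklore] -/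
theorem injective_rowChoice_of_rank_le_one (S : Fin K → Matrix (Fin m) (Fin m) ℝ) (hS : ∀ l, (S l).rank ≤ 1)
    (f : Fin m → Fin K) (hf : Matrix.det (Matrix.of fun i j => S (f i) i j) ≠ 0) : Function.Injective f := by
  intro i j hij
  have h1 : (univ.filter fun i' => f i' = f j).card ≤ 1 :=
    (count_le_rank_of_det_ne_zero S f hf (f j)).trans (hS (f j))
  exact Finset.card_le_one.mp h1 i (Finset.mem_filter.mpr ⟨Finset.mem_univ _, hij⟩) j
    (Finset.mem_filter.mpr ⟨Finset.mem_univ _, rfl⟩)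

/-- **Support of a rank-one pencil**: every monomial is `X^{∑_{l ∈ s} d_l}` for an `m`-SUBSET `s` of the letters. [folklore] -/
theorem support_det_pencil_subset_powersetCard_of_rank_le_one (d : Fin K → ℕ) (S : Fin K → Matrix (Fin m) (Fin m) ℝ)
    (hS : ∀ l, (S l).rank ≤ 1) :
    (Matrix.det (∑ l, ((X : ℝ[X]) ^ d l) • (S l).map C)).support ⊆
      ((Finset.univ : Finset (Fin K)).powersetCard m).image (fun s => ∑ l ∈ s, d l) := by
  intro e he
  obtain ⟨f, hef, hf⟩ := exists_rowChoice_of_mem_support d S he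
  have hinj := injective_rowChoice_of_rank_le_one S hS f hf
  rw [Finset.mem_image]
  refine ⟨Finset.univ.image f, ?_, ?_⟩
  · rw [Finset.mem_powersetCard]
    refine ⟨Finset.subset_univ _, ?_⟩
    rw [Finset.card_image_of_injective _ hinj, Finset.card_univ, Fintype.card_fin]
  · rw [hef, Finset.sum_image fun i _ j _ h => hinj h]

/-- **RANK-ONE MONOMIAL COUNT**: `#supp det ≤ C(K, m)`. [folklore] -/
theorem card_support_le_choose_of_rank_le_one (d : Fin K → ℕ) (S : Fin K → Matrix (Fin m) (Fin m) ℝ)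
    (hS : ∀ l, (S l).rank ≤ 1) :
    (Matrix.det (∑ l, ((X : ℝ[X]) ^ d l) • (S l).map C)).support.card ≤ K.choose m := by
  refine (Finset.card_le_card (support_det_pencil_subset_powersetCard_of_rank_le_one d S hS)).trans ?_
  refine Finset.card_image_le.trans ?_
  rw [Finset.card_powersetCard, Finset.card_univ, Fintype.card_fin]

/-- **RANK-ONE PENCILS AT EVERY SIZE**: if every letter has rank `≤ 1`, the determinant of the `K`-letter pencil of size `m` has at most
`C(K, m) − 1` distinct positive zeros (tree: `2^{K−1} − 1`; format ceiling `C(m+K−1, m) − 1`). [folklore] -/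
theorem card_posRoots_le_choose_sub_one_of_rank_le_one (d : Fin K → ℕ) (S : Fin K → Matrix (Fin m) (Fin m) ℝ)
    (hS : ∀ l, (S l).rank ≤ 1) :
    ((Matrix.det (∑ l, ((X : ℝ[X]) ^ d l) • (S l).map C)).roots.toFinset.filter (fun t => 0 < t)).card ≤
      K.choose m - 1 := by
  by_cases hP : Matrix.det (∑ l, ((X : ℝ[X]) ^ d l) • (S l).map C) = 0
  · rw [hP, Polynomial.roots_zero]
    simp
  · have h1 := Literature.Computability.AlgebraicComplexity.card_roots_toFinset_filter_pos_lt_card_support hP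
    have h2 := card_support_le_choose_of_rank_le_one d S hS
    omega

/-- Rank-one pencils with at least as many rows as letters (`K ≤ m`) have NO positive zero of the determinant: the determinant is a
single monomial (`K = m`) or zero. [folklore] -/
theorem card_posRoots_eq_zero_of_rank_le_one_of_le (d : Fin K → ℕ) (S : Fin K → Matrix (Fin m) (Fin m) ℝ)
    (hS : ∀ l, (S l).rank ≤ 1) (hKm : K ≤ m) :
    ((Matrix.det (∑ l, ((X : ℝ[X]) ^ d l) • (S l).map C)).roots.toFinset.filter (fun t => 0 < t)).card = 0 := by
  have h := card_posRoots_le_choose_sub_one_of_rank_le_one d S hS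
  have hc : K.choose m ≤ 1 := by
    rcases Nat.eq_or_lt_of_le hKm with h' | h'
    · rw [h', Nat.choose_self]
    · rw [Nat.choose_eq_zero_of_lt h']; exact Nat.zero_le _
  omega

/-- Rank-one pencils with one more letter than rows (`K = m + 1`) have at most `m` positive zeros. [folklore] -/
theorem card_posRoots_le_of_rank_le_one_succ (d : Fin (m + 1) → ℕ) (S : Fin (m + 1) → Matrix (Fin m) (Fin m) ℝ)
    (hS : ∀ l, (S l).rank ≤ 1) :
    ((Matrix.det (∑ l, ((X : ℝ[X]) ^ d l) • (S l).map C)).roots.toFinset.filter (fun t => 0 < t)).card ≤ m := by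
  have h := card_posRoots_le_choose_sub_one_of_rank_le_one d S hS
  rw [Nat.choose_succ_self_right] at h
  omega

end Summit.ValiantsHypothesis.ValiantsHypothesis.Theorems.KPlusLogSqLaw.TowerGraft.RankOnePencils
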